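import Literature.MathematicalPhysics.QuantumFieldTheory.Balaban1983to89.BlockAveragingSection
import HarnessLib

/-!
# `Balaban1983to89.BlockAveragingSectionPlaq` — the plaquette variables of the face section: `faceSec V` has the plaquette variables
# of `V` on the EDGE plaquettes of the blocks and trivial ones elsewhere; hence `PlaqSmall δ (faceSec V) ↔ PlaqSmall δ V`

Cell `ym3-torus` (HUMAN RULING D-0037, YM ladder rung R3), seat `ym3-torus-p1` gen 4; sequel of `BlockAveragingSection` (p411383): the
section `faceSec` of Bałaban's (0.4) block averaging not only inverts the averaging but maps SMALL coarse fields to SMALL fine fields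
with the same threshold, so every small-field fibre `{U : Ū = V, |U(∂p) − 1| < δ ∀p}` of a `δ`-small `V` is nonempty.  Elementary
lattice geometry (standing range `j + 1 ≤ m + K`); nothing here is an estimate.

* §1 `offset x ν = (x ν).val mod L` (position of `x` inside its block), `offset_shift_self/_ne`, **`blockOf_shift`**
  (`blockOf (x + e_μ) = blockOf x + e_μ` iff `x` is at the last position of its block in direction `μ`, else `blockOf x`).
* §2 **`plaqHol_faceSec`**: `(faceSec V)(∂p) = V(∂P)` with `P = ⟨blockOf x, μ, ν⟩` if the base point `x` of `p = ⟨x, μ, ν⟩` is at the last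
  position of its block in BOTH directions `μ, ν` (an edge plaquette), and `= 1` otherwise; `wilsonAction4_faceSec_eq_sum`.
* §3 **`plaqSmall_faceSec_iff`** (`δ > 0`): `PlaqSmall δ (faceSec V) ↔ PlaqSmall δ V`; `exists_small_preimage_blockAvg`.

References: T. Bałaban, CMP 109 (1987) 249 [Balaban1987RG1] ((0.3)–(0.4) p.252–253, (0.18) p.255); CMP 98 (1985) 17 [Balaban1985Averaging] ((9) p.19).
-/

noncomputable section

namespace Literature.MathematicalPhysics.QuantumFieldTheory.Balaban1983to89.BlockAveragingSectionPlaq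

open T4Continuum AveragingRT BlockAveraging BlockAveragingSection

variable {P : Params} {j : ℕ} {G : Type*} [GaugeGroup G]

/-! ## §1 In-block offsets; the block of a shifted site -/

/-- The position of `x` inside its block in direction `ν`: `(x ν).val mod L ∈ {0,…,L−1}`. [cite: Balaban1987RG1, (0.3) p.252] -/
def offset (x : Site P j) (ν : Fin P.d) : ℕ := (x ν).val % P.L

/-- `ExitsBlock ⟨x, μ⟩ ↔ offset x μ = L − 1` (definitional). [cite: Balaban1987RG1, (0.3) p.252] -/
theorem exitsBlock_iff (b : PBond P j) : ExitsBlock b ↔ offset b.src b.dir = P.L - 1 := Iff.rfl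

/-- `offset < L`. [cite: Balaban1987RG1, (0.3) p.252] -/
theorem offset_lt (x : Site P j) (ν : Fin P.d) : offset x ν < P.L := Nat.mod_lt _ P.L_pos

/-- Label of `x + e_μ` in direction `μ`: `((x μ).val + 1) mod N_j`. [cite: Balaban1987RG1, (0.1) p.251] -/
theorem val_shift_self (x : Site P j) (μ : Fin P.d) : ((x.shift μ) μ).val = ((x μ).val + 1) % P.sitesPerDir j := by
  rw [Site.shift_apply, if_pos rfl, ZMod.val_add, ZMod.val_one]

/-- Offset of `x + e_μ` in direction `μ`: `(offset x μ + 1) mod L` (standing range: `L ∣ N_j`). [cite: Balaban1987RG1, (0.3) p.252] -/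
theorem offset_shift_self (hj : j + 1 ≤ P.m + P.K) (x : Site P j) (μ : Fin P.d) :
    offset (x.shift μ) μ = (offset x μ + 1) % P.L := by
  have hdvd : P.L ∣ P.sitesPerDir j := Dvd.intro_left _ (P.sitesPerDir_eq_mul_succ hj).symm
  unfold offset
  rw [val_shift_self, Nat.mod_mod_of_dvd _ hdvd, Nat.add_mod, Nat.one_mod_eq_one.mpr (by have := P.hL.2; omega)]

/-- Offsets in the other directions are unchanged by `+ e_μ`. [cite: Balaban1987RG1, (0.3) p.252] -/
theorem offset_shift_ne (x : Site P j) {μ ν : Fin P.d} (h : ν ≠ μ) : offset (x.shift μ) ν = offset x ν := by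
  unfold offset; rw [Site.shift_apply, if_neg h]

/-- `x + e_μ` exits-or-not: `offset (x + e_μ) μ = L − 1 ↔ offset x μ = L − 2`… only the following is needed: if `offset x ν = L − 1`
iff-transfer across a shift in ANOTHER direction. [cite: Balaban1987RG1, (0.3) p.252] -/
theorem exitsBlock_shift_ne (x : Site P j) {μ ν : Fin P.d} (h : ν ≠ μ) :
    ExitsBlock (⟨x.shift μ, ν⟩ : PBond P j) ↔ ExitsBlock (⟨x, ν⟩ : PBond P j) := by
  rw [exitsBlock_iff, exitsBlock_iff]
  show offset (x.shift μ) ν = _ ↔ offset x ν = _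
  rw [offset_shift_ne x h]

/-- **THE BLOCK OF A SHIFTED SITE**: `blockOf (x + e_μ) = blockOf x + e_μ` if `x` is at the last position of its block in direction `μ`,
and `blockOf x` otherwise (standing range). [cite: Balaban1987RG1, (0.3) p.252] -/
theorem blockOf_shift (hj : j + 1 ≤ P.m + P.K) (x : Site P j) (μ : Fin P.d) :
    blockOf (x.shift μ) = if offset x μ = P.L - 1 then (blockOf x).shift μ else blockOf x := by
  have hL := P.L_pos
  have hL1 := P.hL.2
  funext ν
  by_cases hν : ν = μ
  · subst hν
    -- both sides in terms of the label `v = (x ν).val`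
    have hR : (if offset x ν = P.L - 1 then (blockOf x).shift ν else blockOf x) ν =
        if (x ν).val % P.L = P.L - 1 then ((((x ν).val / P.L : ℕ)) : ZMod (P.sitesPerDir (j + 1))) + 1
        else ((((x ν).val / P.L : ℕ)) : ZMod (P.sitesPerDir (j + 1))) := by
      unfold offset
      split_ifs
      · rw [Site.shift_apply, if_pos rfl]; rfl
      · rfl
    rw [hR]
    show (((((x.shift ν) ν).val / P.L : ℕ)) : ZMod (P.sitesPerDir (j + 1))) = _
    rw [val_shift_self]
    have hN : P.sitesPerDir j = P.sitesPerDir (j + 1) * P.L := P.sitesPerDir_eq_mul_succ hj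
    generalize (x ν).val = v
    rw [hN, Nat.mod_mul_left_div_self, ZMod.natCast_mod]
    have hdecomp : v + 1 = P.L * (v / P.L) + (v % P.L + 1) := by have := Nat.div_add_mod v P.L; omega
    rw [hdecomp, Nat.mul_add_div hL]
    by_cases h : v % P.L = P.L - 1
    · rw [if_pos h, h, show P.L - 1 + 1 = P.L by omega, Nat.div_self hL]
      push_cast; ring
    · have hlt : v % P.L + 1 < P.L := by have := Nat.mod_lt v hL; omega
      rw [if_neg h, Nat.div_eq_of_lt hlt, add_zero]
  · have h1 : (blockOf (x.shift μ)) ν = (blockOf x) ν := by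
      simp only [blockOf, Site.shift_apply, if_neg hν]
    rw [h1]
    split_ifs
    · rw [Site.shift_apply, if_neg hν]
    · rfl

/-! ## §2 Plaquette variables of the section -/

/-- **`(faceSec V)(∂p)`**: for `p = ⟨x, μ, ν⟩`, if `x` is at the last position of its block in both directions `μ` and `ν` (an EDGE
plaquette of the block decomposition) then `(faceSec V)(∂p) = V(∂P)` with `P = ⟨blockOf x, μ, ν⟩`; otherwise `(faceSec V)(∂p) = 1`. [cite: Balaban1985Averaging, (9) p.19] -/
theorem plaqHol_faceSec (hj : j + 1 ≤ P.m + P.K) (V : GaugeField P (j+1) G) (p : Plaq P j) :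
    GaugeField.plaqHol (faceSec V) p =
      if offset p.src p.μ = P.L - 1 ∧ offset p.src p.ν = P.L - 1 then
        GaugeField.plaqHol V ⟨blockOf p.src, p.μ, p.ν, p.hμν⟩ else 1 := by
  have hne : p.ν ≠ p.μ := (ne_of_lt p.hμν).symm
  have hne' : p.μ ≠ p.ν := ne_of_lt p.hμν
  -- the four bonds of `∂p`, their exit predicates and values
  have e1 : ExitsBlock (⟨p.src, p.μ⟩ : PBond P j) ↔ offset p.src p.μ = P.L - 1 := exitsBlock_iff _
  have e2 : ExitsBlock (⟨p.src.shift p.μ, p.ν⟩ : PBond P j) ↔ offset p.src p.ν = P.L - 1 :=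
    (exitsBlock_shift_ne p.src hne).trans (exitsBlock_iff _)
  have e3 : ExitsBlock (⟨p.src.shift p.ν, p.μ⟩ : PBond P j) ↔ offset p.src p.μ = P.L - 1 :=
    (exitsBlock_shift_ne p.src hne').trans (exitsBlock_iff _)
  have e4 : ExitsBlock (⟨p.src, p.ν⟩ : PBond P j) ↔ offset p.src p.ν = P.L - 1 := exitsBlock_iff _
  unfold GaugeField.plaqHol
  by_cases hμ : offset p.src p.μ = P.L - 1 <;> by_cases hν : offset p.src p.ν = P.L - 1
  · rw [if_pos ⟨hμ, hν⟩, faceSec_of_exits V (e1.mpr hμ), faceSec_of_exits V (e2.mpr hν), faceSec_of_exits V (e3.mpr hμ),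
      faceSec_of_exits V (e4.mpr hν)]
    show V ⟨blockOf p.src, p.μ⟩ * V ⟨blockOf (p.src.shift p.μ), p.ν⟩ * (V ⟨blockOf (p.src.shift p.ν), p.μ⟩)⁻¹ *
        (V ⟨blockOf p.src, p.ν⟩)⁻¹ =
      V ⟨blockOf p.src, p.μ⟩ * V ⟨(blockOf p.src).shift p.μ, p.ν⟩ * (V ⟨(blockOf p.src).shift p.ν, p.μ⟩)⁻¹ *
        (V ⟨blockOf p.src, p.ν⟩)⁻¹
    rw [blockOf_shift hj p.src p.μ, if_pos hμ, blockOf_shift hj p.src p.ν, if_pos hν]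
  · rw [if_neg (fun h => hν h.2), faceSec_of_exits V (e1.mpr hμ), faceSec_of_not_exits V (fun h => hν (e2.mp h)),
      faceSec_of_exits V (e3.mpr hμ), faceSec_of_not_exits V (fun h => hν (e4.mp h))]
    show V ⟨blockOf p.src, p.μ⟩ * 1 * (V ⟨blockOf (p.src.shift p.ν), p.μ⟩)⁻¹ * 1⁻¹ = 1
    rw [blockOf_shift hj p.src p.ν, if_neg hν]
    group
  · rw [if_neg (fun h => hμ h.1), faceSec_of_not_exits V (fun h => hμ (e1.mp h)), faceSec_of_exits V (e2.mpr hν),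
      faceSec_of_not_exits V (fun h => hμ (e3.mp h)), faceSec_of_exits V (e4.mpr hν)]
    show 1 * V ⟨blockOf (p.src.shift p.μ), p.ν⟩ * 1⁻¹ * (V ⟨blockOf p.src, p.ν⟩)⁻¹ = 1
    rw [blockOf_shift hj p.src p.μ, if_neg hμ]
    group
  · rw [if_neg (fun h => hμ h.1), faceSec_of_not_exits V (fun h => hμ (e1.mp h)), faceSec_of_not_exits V (fun h => hν (e2.mp h)),
      faceSec_of_not_exits V (fun h => hμ (e3.mp h)), faceSec_of_not_exits V (fun h => hν (e4.mp h))]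
    group

/-- The Wilson action of the section is the sum of `1 − Re tr V(∂P(p))` over the EDGE plaquettes `p` (`P(p) = ⟨blockOf x, μ, ν⟩`);
all other plaquettes contribute `0`. [cite: Balaban1987RG1, (0.2) p.252] -/
theorem wilsonAction4_faceSec_eq_sum (hj : j + 1 ≤ P.m + P.K) (V : GaugeField P (j+1) G) :
    wilsonAction4 (faceSec V) = ∑ p : Plaq P j,
      if offset p.src p.μ = P.L - 1 ∧ offset p.src p.ν = P.L - 1 then
        (1 - reTr (GaugeField.plaqHol V ⟨blockOf p.src, p.μ, p.ν, p.hμν⟩)) else 0 := by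
  unfold wilsonAction4 wilsonAction
  refine Finset.sum_congr rfl fun p _ => ?_
  rw [one_mul, plaqHol_faceSec hj V p]
  split_ifs
  · rfl
  · rw [GaugeGroup.reTr_one, sub_self]

/-! ## §3 Small coarse fields have small sections -/

/-- **`PlaqSmall δ V ⇒ PlaqSmall δ (faceSec V)`** for `δ > 0`: the section of a `δ`-small coarse field is `δ`-small. [cite: Balaban1987RG1, (0.18) p.255] -/
theorem plaqSmall_faceSec (hj : j + 1 ≤ P.m + P.K) {δ : ℝ} (hδ : 0 < δ) {V : GaugeField P (j+1) G} (hV : PlaqSmall δ V) :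
    PlaqSmall δ (faceSec V) := fun p => by
  rw [plaqHol_faceSec hj V p]
  split_ifs
  · exact hV _
  · rw [GaugeGroup.dist1_one]; exact hδ

/-- Offsets of a block site are its parameters: `offset (blockSite y r) ν = r ν` (standing range). [cite: Balaban1987RG1, (0.3) p.252] -/
theorem offset_blockSite (hj : j + 1 ≤ P.m + P.K) (y : Site P (j+1)) (r : Fin P.d → Fin P.L) (ν : Fin P.d) :
    offset (Site.blockSite y r) ν = r ν := by
  unfold offset
  rw [Site.val_blockSite hj, Nat.mul_add_mod', Nat.mod_eq_of_lt (r ν).isLt]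

/-- Conversely every coarse plaquette variable `V(∂P)` IS a plaquette variable of the section (at the corner edge plaquette of
`B(P₋)`), so **`PlaqSmall δ (faceSec V) ↔ PlaqSmall δ V`** (`δ > 0`). [cite: Balaban1987RG1, (0.18) p.255] -/
theorem plaqSmall_faceSec_iff (hj : j + 1 ≤ P.m + P.K) {δ : ℝ} (hδ : 0 < δ) (V : GaugeField P (j+1) G) :
    PlaqSmall δ (faceSec V) ↔ PlaqSmall δ V := by
  refine ⟨fun h Q => ?_, plaqSmall_faceSec hj hδ⟩
  have hL := P.hL.2
  -- the corner site of `B(Q₋)`: all offsets `L − 1`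
  let x : Site P j := Site.blockSite Q.src fun _ => ⟨P.L - 1, by omega⟩
  have hx : ∀ ν, offset x ν = P.L - 1 := fun ν => offset_blockSite hj Q.src _ ν
  have hp := h ⟨x, Q.μ, Q.ν, Q.hμν⟩
  rw [plaqHol_faceSec hj V, if_pos ⟨hx _, hx _⟩] at hp
  have hb : blockOf x = Q.src := Site.blockOf_blockSite hj Q.src _
  simp only [hb] at hp
  exact hp

/-- **EVERY SMALL COARSE FIELD HAS A SMALL PREIMAGE**: for `δ > 0`, a `δ`-small `V` on `T^{(j+1)}` is the (0.4) block average of a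
`δ`-small configuration on `T^{(j)}` (every `ℰ` with `ℰ(1,…,1) = 1`, standing range). [cite: Balaban1987RG1, (0.4)/(0.18) p.253] -/
theorem exists_small_preimage_blockAvg (hj : j + 1 ≤ P.m + P.K) (ℰ : LoopAverage G)
    (hE : ∀ n : ℕ, ℰ.E (fun _ : Fin (n + 1) => (1 : G)) = 1) {δ : ℝ} (hδ : 0 < δ) {V : GaugeField P (j+1) G}
    (hV : PlaqSmall δ V) : ∃ U : GaugeField P j G, (blockAvg ℰ).avg U = V ∧ PlaqSmall δ U :=
  ⟨faceSec V, blockAvg_faceSec hj ℰ hE V, plaqSmall_faceSec hj hδ hV⟩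

end Literature.MathematicalPhysics.QuantumFieldTheory.Balaban1983to89.BlockAveragingSectionPlaq

end
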